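import Summits.Langlands.Langlands.Theorems.IrreducibilityBySelfDualityReciprocityUpToIrreducibilityRStringBasics
import Summits.Langlands.Langlands.Theorems.IrreducibilityBySelfDualityReciprocityUpToIrreducibilityRStringIso
import HarnessLib

/-!
# Strings in Frobenius-semisimple Weil–Deligne representations: the dimension of a string

Helper file for stub S-17a-B `stub_isEquivalent_of_finrank_invariants_tprod_eq` of line `Sketch`
(crux stmt-Langlands-17925 `IrreducibilityBySelfDuality.ReciprocityUpToIrreducibilityR`), registered
sub-goal W-c `stub_finrank_stringSpan`: for a string head `H` of length `e` in `σ = (ρ, N)` (so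
`N^e H = 0` and `N^{e-1}` is injective on `H`) the string `H + N H + ⋯ + N^{e-1} H` is the ISOMORPHIC
image of `H^e` under the string map `(y_j) ↦ Σ_j N^j y_j` (the linear isomorphism
`exists_strEquivHead` of `…RStringIso`: injective on `H^e` by the independence of the pieces of a
string, surjective by definition), whence `dim string(H, e) = e · dim H`
(Tate, Corvallis 1979, (4.1.5): `dim (ρ_H ⊗ Sp(e)) = e · dim ρ_H`).
Pure linear algebra over the tree's `WeilDeligneRep`; no definitions; standard axioms only.
-/

noncomputable section

set_option linter.dupNamespace false

open Module
open Literature.NumberTheory.Automorphic Literature.NumberTheory.GaloisRepresentations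
open Literature.NumberTheory.GaloisRepresentations.WeilGroup
open Literature.NumberTheory.GaloisRepresentations.IsNonarchimedeanLocalField

namespace Summit.Langlands.Langlands.Theorems.ReciprocityUpToIrreducibilityR

variable {F : Type} [Field F] [ValuativeRel F] [TopologicalSpace F] [IsNonarchimedeanLocalField F]
variable {V : Type*} [AddCommGroup V] [Module ℂ V]

/-- **The string over a string head is parametrised by `H^e`.**  For a string head `H` of length `e` in
`σ = (ρ, N)`, the string map `(y_j) ↦ Σ_{j<e} N^j y_j` is a linear isomorphism
`H^e ≃ H + N H + ⋯ + N^{e-1} H` (the bundled-hypothesis form of `exists_strEquivHead`).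
[cite: TateCorvallis1979, (4.1.5)] -/
theorem exists_stringEquiv {σ : WeilDeligneRep F ℂ V} {H : Submodule ℂ V} {e : ℕ}
    (h : IsStringHead σ H e) :
    ∃ Ψ : (Fin e → ↥H) ≃ₗ[ℂ] ↥(stringSpan σ H e), ∀ y, (Ψ y : V) = strMap σ e (fun j => (y j : V)) :=
  exists_strEquivHead σ H e h.le_ker h.disjoint_ker

/-- **Dimension of a string**: `dim (H + N H + ⋯ + N^{e-1} H) = e · dim H` for a string head `H` of
length `e` (the string is the isomorphic image of `H^e`). [cite: TateCorvallis1979, (4.1.5)] -/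
theorem finrank_stringSpan [FiniteDimensional ℂ V] {σ : WeilDeligneRep F ℂ V} {H : Submodule ℂ V}
    {e : ℕ} (h : IsStringHead σ H e) : finrank ℂ ↥(stringSpan σ H e) = e * finrank ℂ ↥H := by
  obtain ⟨Ψ, -⟩ := exists_stringEquiv h
  rw [← Ψ.finrank_eq, Module.finrank_pi_fintype, Finset.sum_const, Finset.card_univ, Fintype.card_fin,
    smul_eq_mul]

/-- **Registered sub-goal `stub_finrank_stringSpan` (dimension of a string)**: for a string head `H` of
length `e` in `σ = (ρ, N)`, `dim (H + N H + ⋯ + N^{e-1} H) = e · dim H`, the string map being a linear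
isomorphism `H^e ≃ string(H, e)` by the independence of the pieces of a string.
[cite: TateCorvallis1979, (4.1.5)] -/
theorem stub_finrank_stringSpan : ∀ (F : Type) [Field F] [ValuativeRel F] [TopologicalSpace F] [IsNonarchimedeanLocalField F] (V : Type) [AddCommGroup V] [Module ℂ V] [FiniteDimensional ℂ V] (σ : WeilDeligneRep F ℂ V) (H : Submodule ℂ V) (e : ℕ), IsStringHead σ H e → Module.finrank ℂ ↥(stringSpan σ H e) = e * Module.finrank ℂ ↥H :=
  fun _ _ _ _ _ _ _ _ _ _ _ _ h => finrank_stringSpan h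

end Summit.Langlands.Langlands.Theorems.ReciprocityUpToIrreducibilityR

end
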